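import Summits.AtomisticToContinuum.Crystallization.Theorems.ExcessDecayLiouvillePhononStabilityDefs

/-!
# `PhononStability` (stmt-AtomisticToContinuum-9333), line `contragredient-window-collapse` (reshaped, lead c1): FAR-FIELD VOCABULARY

Far field of the reshaped line: classes of reference length `2 < ‖ζ⁰‖ ≤ R_f` are charged, by a weighted
Cauchy–Schwarz along a CHAIN of star classes (`‖ζ⁰‖ ≤ 2`), to DIRECTIONAL star-range forms
`dirForm (ζ_c(δ)) s w = Σ_k ⟪ζ_c(δ), Δ_s w k⟫²`; classes `R_f < ‖ζ⁰‖ ≤ R_∞` are charged to the plain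
nearest-neighbour form `N0` through an explicit nearest-neighbour PATH constant; classes beyond `R_∞` by the
analytic lattice-sum tail.  The near certificate then has to dominate only star-range forms.

This file extends the line's vocabulary (`ExcessDecayLiouvillePhononStabilityDefs.lean`, p87776) for the RESHAPED skeleton v5
(`Cruxes/PhononStability/Lines/contragredient_window_collapse.lean`, lead prover-line-stmt-AtomisticToContinuum-9333-c1-0): the dead
`VertexCertificate`/`TailControl`/`DilationReduction` route (vertex formats need >= 1e4 fixed-coefficient operators at range R >= 5,
lead -0's S5 analysis) is replaced by a three-range far field (chain charges to star-range directional forms on `(Rn, Rf]`,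
nearest-neighbour path charges on `(Rf, Rinf]`, analytic lattice tail beyond `Rinf`) and a near certificate on the exact range `Rn`
(parametric sum-of-squares cells, computational).  Definitions: `dirForm chainEnd IsChain chainConst chainCharge farClasses chargeSum
ValidChains MidBound pathConst farTailConst`; stub statements `ChainBound PathBound LatticeCount TailSum FarControl NearCertificate`, each a proof
OBLIGATION of the line to be landed by a `--supports` file as `theorem stub_<name> : <Statement>`; `stub_farDefs` is the registered anchor.
Everything is `[folklore]` bookkeeping of this line; nothing here closes an item.
-/

noncomputable section

open scoped BigOperators Classical InnerProductSpace
open Filter Set Function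
open Literature.MathematicalPhysics.StatisticalMechanics
open Summit.AtomisticToContinuum.Crystallization.Theses.ExcessDecayLiouville
open Summit.AtomisticToContinuum.Crystallization.Theorems.PhononStabilityNegative

namespace Summit.AtomisticToContinuum.Crystallization.Theorems.PhononStabilityCWC

local notation "E3" => EuclideanSpace ℝ (Fin 3)

/-- Directional class functional `Σ_k ⟪v, Δ_s w k⟫²` (`longForm δ c = dirForm (bondVec δ c) c`). [folklore] -/
def dirForm (v : E3) (s : BondClass) (w : Label → E3) : ℝ := ∑' k, (inner ℝ v (bondDiff s w k)) ^ 2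

/-- End label class `(m', n)` reached from sublattice `m` by composing the classes of a chain in order
(`none` if some step does not start where the previous one ended). [folklore] -/
def chainEnd : Fin 2 → List BondClass → Option (Fin 2 × (Fin 3 → ℤ))
  | m, [] => some (m, 0)
  | m, s :: rest => if s.1 = m then (chainEnd s.2.1 rest).map fun p => (p.1, s.2.2 + p.2) else none

/-- `ch` is a chain of classes composing to the class `c`. [folklore] -/
def IsChain (c : BondClass) (ch : List BondClass) : Prop := chainEnd c.1 ch = some (c.2.1, c.2.2)

/-- Chain constant `W(ch) = Σ_j ‖ζ⁰_{s_j}‖` (the weights of the weighted Cauchy–Schwarz are `1/‖ζ⁰_{s_j}‖`,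
which makes straight chains exact on affine fields). [folklore] -/
def chainConst (ch : List BondClass) : ℝ := (ch.map fun s => ‖bondVec 0 s‖).sum

/-- The chain charge of class `c` along `ch` at shift `δ`:
`W(ch) · Σ_j ‖ζ⁰_{s_j}‖⁻¹ · dirForm (ζ_c(δ)) s_j w` (an upper bound for `longForm δ c w`). [folklore] -/
def chainCharge (δ : E3) (c : BondClass) (ch : List BondClass) (w : Label → E3) : ℝ :=
  chainConst ch * (ch.map fun s => ‖bondVec 0 s‖⁻¹ * dirForm (bondVec δ c) s w).sum

/-- Classes of reference length in `(Rn, Rf]`. [folklore] -/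
def farClasses (Rn Rf : ℝ) : Finset BondClass := (classesR Rf).filter fun c => c ∉ classesR Rn

/-- Total chain charge of the range `(Rn, Rf]` with the EXACT far coefficients `|ω(‖Aζ_c(δ)‖)|`. [folklore] -/
def chargeSum (Rn Rf : ℝ) (chain : BondClass → List BondClass) (A : E3 →L[ℝ] E3) (δ : E3)
    (w : Label → E3) : ℝ :=
  ∑ c ∈ farClasses Rn Rf, |omegaLJ ‖A (bondVec δ c)‖| * chainCharge δ c (chain c) w

/-- Valid chain assignment on a range: every class gets a chain of non-diagonal steps composing to it. [folklore] -/
def ValidChains (Rn Rf : ℝ) (chain : BondClass → List BondClass) : Prop :=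
  ∀ c ∈ farClasses Rn Rf, IsChain c (chain c) ∧ ∀ s ∈ chain c, ¬ diagClass s

/-- A MID-RANGE bound assignment: on `(Rf, Rinf]` every class gets a nonnegative constant `P c` with
`Σ_k ‖Δ_c w k‖² ≤ P c · N0 w` for all finitely supported `w` (the certificate produces `P` by recursive halving
`√P(ζ₁+ζ₂) ≤ √P(ζ₁) + √P(ζ₂)` down to star classes; spectral quality `P c ≈ ‖ζ⁰_c‖²/4`). [folklore] -/
def MidBound (Rf Rinf : ℝ) (P : BondClass → ℝ) : Prop :=
  ∀ c ∈ farClasses Rf Rinf, 0 ≤ P c ∧ ∀ w : Label → E3, (Function.support w).Finite → plainForm c w ≤ P c * N0 w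

/-- Explicit nearest-neighbour PATH constant of a class `(m, m', n)`: length × maximal class multiplicity of
the canonical path (`|n₂|` vertical inter-sublattice double steps, `|n₀|` steps `±u`, `|n₁|` steps `±v`,
one inter step if `m ≠ m'`). [folklore] -/
def pathConst (c : BondClass) : ℝ :=
  ((2 * |c.2.2 2| + |c.2.2 0| + |c.2.2 1| + 1 : ℤ) : ℝ) * ((max (max |c.2.2 0| |c.2.2 1|) |c.2.2 2| + 1 : ℤ) : ℝ)

/-- The far-far lattice constant `Σ_{‖ζ⁰_c‖ > R} 18‖ζ⁰_c‖⁻⁸ · pathConst c`. [folklore] -/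
def farTailConst (R : ℝ) : ℝ := ∑' c, if c ∈ classesR R then 0 else farCoeff c * pathConst c

/-! ## v4 stub statements -/

/-- **S6 — CHAIN BOUND** (weighted Cauchy–Schwarz along a chain, the far-field device of the line): for a
chain `ch` composing to `c`, positive weights `wt` on its steps, every direction `v` and finitely supported `w`,
`Σ_k ⟪v, Δ_c w k⟫² ≤ (Σ_j wt s_j) · Σ_j (wt s_j)⁻¹ Σ_k ⟪v, Δ_{s_j} w k⟫²`
(telescoping `Δ_c w k = Σ_j Δ_{s_j} w (k + o_j)`, `(Σ a_j)² ≤ (Σ ℓ_j)(Σ a_j²/ℓ_j)`, re-indexing `k + o_j ↦ k`);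
used with `wt s = ‖ζ⁰_s‖` (chain charges: exact on affine fields along straight chains), `wt = 1` (paths) and
`wt s = √p_s` (mid-range constants). -/
def ChainBound : Prop :=
  ∀ (c : BondClass) (ch : List BondClass), IsChain c ch → ∀ wt : BondClass → ℝ, (∀ s ∈ ch, 0 < wt s) →
    ∀ (v : E3) (w : Label → E3), (Function.support w).Finite →
      dirForm v c w ≤ (ch.map wt).sum * (ch.map fun s => (wt s)⁻¹ * dirForm v s w).sum

/-- **S7 — PATH BOUND** (plain far differences against the nearest-neighbour form): for a non-diagonal class,
`Σ_k ‖Δ_c w k‖² ≤ pathConst c · N0 w` (the canonical nearest-neighbour path, `ChainBound` with unit weights applied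
to the three coordinate directions, and class multiplicities along the path). -/
def PathBound : Prop :=
  ChainBound → ∀ c : BondClass, ¬ diagClass c → ∀ w : Label → E3, (Function.support w).Finite →
    plainForm c w ≤ pathConst c * N0 w

/-- **S8 — LATTICE COUNT** (packing): a finite set of points of a shifted copy of the period lattice inside a
ball of radius `ρ` has at most `(2ρ + 1)³` elements (balls of radius `1/2` around them are disjoint —
`‖latVec (n − n')‖ ≥ 1` — and lie in the ball of radius `ρ + 1/2`; compare volumes). -/
def LatticeCount : Prop :=
  ∀ (y : E3) (ρ : ℝ), 0 ≤ ρ → ∀ s : Finset (Fin 3 → ℤ), (∀ n ∈ s, ‖latVec n + y‖ ≤ ρ) →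
    (s.card : ℝ) ≤ (2 * ρ + 1) ^ 3

/-- **S9 — TAIL SUM** (the analytic far-far constant): for `R ≥ 100` the lattice sum
`Σ_{‖ζ⁰_c‖ > R} 18‖ζ⁰_c‖⁻⁸ pathConst c` converges and is `≤ 40000/R³`
(`pathConst c ≤ 6.4‖ζ⁰_c‖²` for `‖ζ⁰_c‖ ≥ 100` from the coordinate formula
`36‖ζ⁰‖² = 9(2n₀+n₁+s)² + 3(3n₁+s)² + 24(2n₂+s)²`; dyadic shells counted by `LatticeCount` on the four
shifted lattices `latVec ℤ³ + {0, ±innerRef}`: `Σ_{ρ>R} ρ⁻⁶ ≤ 4 · 74.2/R³`). -/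
def TailSum : Prop :=
  LatticeCount → ∀ R : ℝ, 100 ≤ R →
    Summable (fun c : BondClass => if c ∈ classesR R then 0 else farCoeff c * pathConst c) ∧
      farTailConst R ≤ 40000 / R ^ 3

/-- **S10 — FAR CONTROL** (three-range far field, `tsum` form): given the chain and path bounds, on the
window, for `2 ≤ Rn ≤ Rf ≤ R∞`, a valid chain assignment on `(Rn, Rf]` and a finitely supported `w` with
summable class family,
`−chargeSum − (Σ_{(Rf,R∞]} farCoeff·P)·N0 − farTailConst R∞ · N0 ≤ Σ'_{‖ζ⁰‖ > Rn} classTerm`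
(on the window far bonds have actual length `> 1.86`: `ψ ≥ 0` dropped, `ω·X ≥ −|ω|·X`, then `ChainBound`
on `(Rn,Rf]`, the landed `neg_farCoeff_mul_le` + the mid-range assignment `P` on `(Rf,R∞]`, + `PathBound` beyond `R∞`). -/
def FarControl : Prop :=
  ChainBound → PathBound → ∀ (Rn Rf Rinf : ℝ), 2 ≤ Rn → Rn ≤ Rf → Rf ≤ Rinf →
    ∀ chain : BondClass → List BondClass, ValidChains Rn Rf chain → ∀ P : BondClass → ℝ, MidBound Rf Rinf P →
    Summable (fun c : BondClass => if c ∈ classesR Rinf then 0 else farCoeff c * pathConst c) →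
    ∀ (A B : E3 →L[ℝ] E3) (δ : E3) (w : Label → E3), CellWindow A → ShiftWindow A δ →
      (Function.support w).Finite → LatticeSummable w → Summable (classTerm A B δ w) →
        -chargeSum Rn Rf chain A δ w - (∑ c ∈ farClasses Rf Rinf, farCoeff c * P c) * N0 w
            - farTailConst Rinf * N0 w
          ≤ ∑' c, if c ∈ classesR Rn then 0 else classTerm A B δ w c

/-- **S11 — NEAR CERTIFICATE** (the transfer target C⁺ of the reshaped line; computational): for some `κ > 0`
and ranges `2 ≤ Rn ≤ Rf ≤ R∞`, `R∞ ≥ 100`, with a valid chain assignment, the EXACT finite-range form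
`Σ_{‖ζ⁰‖ ≤ Rn} classTerm` dominates `2κ·Σ_nn metricForm` plus all three far charges (chain charges with a valid
chain assignment on `(Rn,Rf]`, a mid-range assignment `P` with `MidBound` on `(Rf,R∞]`, the analytic tail constant
`40000/R∞³`), uniformly on the window (to be proved cell by cell by parametric sum-of-squares certificates checked in
the kernel, together with the recursive-halving proof of `MidBound`). -/
def NearCertificate : Prop :=
  ∃ κ : ℝ, 0 < κ ∧ ∃ (Rn Rf Rinf : ℝ) (chain : BondClass → List BondClass) (P : BondClass → ℝ),
    2 ≤ Rn ∧ Rn ≤ Rf ∧ Rf ≤ Rinf ∧ 100 ≤ Rinf ∧ ValidChains Rn Rf chain ∧ MidBound Rf Rinf P ∧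
    ∀ (A B : E3 →L[ℝ] E3) (δ : E3) (w : Label → E3), CellWindow A → ShiftWindow A δ → Contragredient A B →
      (Function.support w).Finite →
        2 * κ * (∑ c ∈ nnClasses, metricForm B c w) + chargeSum Rn Rf chain A δ w
            + (∑ c ∈ farClasses Rf Rinf, farCoeff c * P c) * N0 w + 40000 / Rinf ^ 3 * N0 w
          ≤ ∑ c ∈ classesR Rn, classTerm A B δ w c

/-! ## Anchor -/

/-- Registered anchor sub-goal of the reshaped line (`stub_farDefs`): units sanity of the far-field bookkeeping (the
empty chain has constant `0`; the diagonal class has path constant `1`); its landing puts this vocabulary in the tree. [folklore] -/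
theorem stub_farDefs : chainConst [] = 0 ∧ pathConst ((0 : Fin 2), (0 : Fin 2), (0 : Fin 3 → ℤ)) = 1 := by
  constructor
  · simp [chainConst]
  · simp [pathConst]

end Summit.AtomisticToContinuum.Crystallization.Theorems.PhononStabilityCWC

end
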